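import Literature.MathematicalPhysics.QuantumFieldTheory.Balaban1983to89.B8Thm4UniqueLocal
import Literature.MathematicalPhysics.QuantumFieldTheory.Balaban1983to89.B8Eq1110Concrete

/-!
# `Balaban1983to89.B8Thm4ExistsLocal` — T. Bałaban, *Spaces of regular gauge field configurations on a lattice and gauge fixing
# conditions*, Commun. Math. Phys. **99** (1985) 75–102 [Balaban1985RegularSpaces] ("B8"), THEOREM 4 p. 88, THE EXISTENCE CLAUSE AT
# LEVEL `k`, proof pp. 89 + 94–95: «The composition u = u′u₁ of these two gauge transformations is the transformation we are looking
# for» … «It gives us a gauge transformation u = u′u₁ such that the conditions (1.29), (1.37), (1.38) are satisfied … (1.110), hence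
# (1.111)» — ASSEMBLED ON THE CONCRETE `ℤᵈ` CARRIERS (tower-local, general background) from the inductive input (1.68)–(1.69),
# Proposition 5's existence clause (1.107)–(1.108) in concrete form (hypothesis) and the tree's (1.110)–(1.111)

statement-level skeleton of published theorems with citation tags; proofs where landed; nothing here is a claim about the
Yang–Mills mass gap

PDF held: `paper:balaban1985-cmp99-regular-spaces-gauge-fixing` (journal page = PDF page + 74); pp. 88–89 [PDF 14–15] and 94–95 [PDF 20–21]
read on the text layer by this seat (2026-08-26).

WHAT IS PRINTED.  p. 88: "Thus let us assume that Theorem 4 holds for some `k − 1` and we will prove it for `k`. … Applying the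
inductive hypothesis we get a gauge transformation `u₁` such that … (1.68) … `U₁ = U′^{u₁⁻¹} = e^{iηA}`, `|A| < B₁(α₀ + α₁)(Lʲη)⁻¹`, … on
`Ω_j`, `j = 0, 1, …, k − 1`. (1.69) … It is clear from (1.69) that we have to improve the bounds on the domain `Ω_k`."  p. 89: "The gauge
transformation `u₁` transforms the configuration `U′` into the configuration `U₁` which is sufficiently regular and close to 1. We want
to find another gauge transformation `u′` which transforms `U₁` into a configuration `U₁^{u′⁻¹}` satisfying the conditions (1.37),
(1.38), (1.67) and which satisfies the conditions `\overline{R₀u′u₁}^j = 1` on `Λ_j`. The composition `u = u′u₁` of these two gauge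
transformations is the transformation we are looking for."  p. 94, Proposition 5: "there exists a configuration `u′ = e^{iλ}`
satisfying the equations `RD*(1/(iη)) log U₁^{u′⁻¹} = 0`, `\overline{R₀u′u₁}^j = 1` on `Λ_j`, `j = 0, 1, …, k` (1.107) and the bounds
`|λ|, |Dλ|₍₋₁₎ < 8B′₀B₁(α₀ + α₁)`. (1.108)"; pp. 94–95: "Now let us consider implications of the proposition concerning the inductive
proof of the Theorem 4. It gives us a gauge transformation `u = u′u₁` such that the conditions (1.29), (1.37), (1.38) are satisfied.
This follows from the inductive construction of `u₁` and from (1.107). The bounds (1.108) and the representation (1.84) imply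
`|(1/iη) log(U₁^{u′⁻¹})_b| ≦ |A_b| + |g(i ad_{λ(b₋)})(Dλ)(b)| + O(1)η|(Dλ)(b)||A_b| < …` on `Ω_j`, `j = 0, 1, …, k − 1`, (1.110) hence
`|(1/iη) log(U₁^{u′⁻¹})_b| < C′₁B₁(α₀ + α₁)(Lʲη)⁻¹` on `Ω_j`, `j = 0, 1, …, k`, (1.111) where `C′₁` is an absolute constant depending on
`d` and `L` only. Thus all the assumptions of Proposition 3 are satisfied and for `α₀ + α₁` sufficiently small it implies Theorem 4, except
the uniqueness statement."

WHY THIS FILE (the N05 KNIT seat's assembly of the existence branch `t4e_of : Ind k → P5e k → E110 k → P3 k → T4e k` of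
`B8.Thm4SkeletonR`, at the concrete level).  The sibling `B8Thm4UniqueLocal` (this seat) knits the uniqueness clause modulo Proposition
5's (1.109).  Here the EXISTENCE clause at level `k` is knitted from: the inductive datum `(u₁, U₁ = U′^{u₁⁻¹}, A)` with `U₁ = e^{iηA}` and the
first bound of (1.69) READ ON THE TOWERS `Bʲ(y)`, `y ∈ Λ_j`, `j ≤ k` (hypothesis `h69` — the Theorem at level `k − 1` plus Proposition 3,
with the one-level-up reading of the `Ω_{k−1}` bound on `Ω_k`, `B8Eq1110Concrete.ineq1111_of_1110`, folded into its constant `c`);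
Proposition 5's existence clause for that datum in concrete tower-local form (hypothesis data `v, λ`: `v = e^{iλ}` on the towers with
(1.108), solving (1.107) — the Landau equation an ABSTRACT predicate `Lan` of the configuration `U₁^{v⁻¹}`, its operator `R(U₀)` not yet an
object of the tree on these carriers, interface I-B8-2); and the tree's kernel theorem for (1.110) (`B8Eq1110Concrete.ineq1110_scaled`, seat
`pub-ymgap-dag-n04-b`, from (1.84) `B8Eq184Proof.eq184`).  OUTPUT = the conclusion of `B8.Thm4ExistsBody` at the datum: a gauge
transformation `u = u₁v` (print `u′u₁`) with (1.29) (`Restr129`), whose `U′^{u⁻¹} = U₁^{v⁻¹}` satisfies (1.38) (`Lan`) and (1.62) in the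
tower-local exponential reading «`U′^{u⁻¹} = e^{iηA′}` on the bonds of `Bʲ(Λ_j)` with `|A′| ≤ B′₁(α₀ + α₁)(Lʲη)⁻¹`», `A′` the bondwise
logarithm, self-adjoint (print's `𝔤`-valued) for unitary data.  (1.37) for `U′^{u⁻¹}` is the gauge-covariance identity of the averages
(`B8Eq137QjEqB`, r05) — a law of the carrier, not of this step — and is not restated here.

WHAT THIS FILE PROVES (kernel, 0 sorry, theorems only, no `def`; conventions as in `B8Thm4UniqueLocal` / `B8Eq1110Concrete`: moving
frame `U^{u} = mgauge U₀ u U` ((55) of [3] = (1.17)), `e^{iηA} = cfgExp η A`, `e^{iλ} = gaugeExp λ`, `(Dλ)(b) = covDerivFwd`, `log` = the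
series (21) of [3] `MatrixLog.mlog`, print's `i` kept; tower `Bʲ(y) = [tlo L y j, thi L y j]`).
* §1 device: `‖xyz − 1‖ ≤ (‖x − 1‖ + 1)(‖y − 1‖ + 1)(‖z − 1‖ + 1) − 1`; the three exponential factors of (1.81)
  (`B8Eq184Proof.eq181`) are close to `1` under (1.69)/(1.108), so `‖(U₁^{v⁻¹})_b − 1‖ ≤ 1/4` at a tower bond (`norm_W_sub_one_le`) — whence
  `e^{log W_b} = W_b` (`MatrixLog.exp_mlog`) and, for unitary data, `((1/iη) log W_b)⋆ = (1/iη) log W_b` (`B7Prop2Explicit.star_mlog_eq_neg`).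
* §2 `bond_1110_local` — AT ONE TOWER BOND: `U₁^{v⁻¹}` read there in the exponential letters (`v = e^{iλ}` at both ends, `U₁ = e^{iηA}` at
  the bond), then (1.110): `‖A′_b‖ ≤ (2c + 8α₄)(Lʲη)⁻¹` for `A′_b = (1/iη) log(U₁^{v⁻¹})_b`, and `e^{iηA′_b} = (U₁^{v⁻¹})_b`.
* §3 **`thm4_exists_step_local`** — THE EXISTENCE CLAUSE OF THEOREM 4 AT LEVEL `k`, GIVEN THE INDUCTIVE DATUM AND PROPOSITION 5's
  EXISTENCE CLAUSE: `∃ u` (namely `u₁v`) with `Restr129 L k Λ U₀ u`, `Lan (U′^{u⁻¹})`, and `∃ A′` with `U′^{u⁻¹} = e^{iηA′}` on the bonds of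
  every `Bʲ(y)`, `y ∈ Λ_j`, `j ≤ k` (`AgreeOn`), `A′` self-adjoint there, `‖A′‖ ≤ (2c + 8α₄)(Lʲη)⁻¹` there — (1.29), (1.38), (1.62) with
  `B′₁(α₀ + α₁) := 2c + 8α₄` (`c = L·B₁(α₀ + α₁)`, `α₄ = 8B′₀B₁(α₀ + α₁)`: print's `C′₁ = (2 + 16B′₀)L` up to the tree's constants of
  `B8Eq1110Concrete`, declared there); `thm4_exists_step_witness` — the same with the witness `u = u₁v`, `U′^{u⁻¹} = U₁^{v⁻¹}` displayed.

READINGS / DECLARED DEVIATIONS.  (i) TOWER-LOCAL currency (as `B8Thm4UniqueLocal` READING (i)); the inductive bound (1.69) is taken on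
ALL towers `j ≤ k` with one constant `c` (print: `B₁(α₀ + α₁)` on `Ω_j`, `j ≤ k − 1`, read on `Ω_k ⊂ Ω_{k−1}` at the cost of a factor `L` —
`ineq1111_of_1110`; the consumer sets `c = L·B₁(α₀ + α₁)`).  (ii) Proposition 5's existence clause enters as DATA `(v, λ)` with its printed
properties (equivalent to the `∃`-form); `Lan` abstract, read only through «`U₁^{v⁻¹}` satisfies it»; `v` unitary-valued on `ℤᵈ` (the
provider extends `e^{iλ}` by `1` off `Ω₀`).  (iii) Smallness explicit and merely sufficient (`α₄ ≤ 1/84`, `c ≤ 1/12`) for print's «for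
α₀ + α₁ sufficiently small»; `≤` for `<`.  (iv) The step consumes NO regularity of `U₀` and no (1.68)/(1.73)/(1.74) of `u₁`: those are
hypotheses OF Proposition 5 (inside the provider of `v, λ`), exactly as in print's paragraph.  NOT CLAIMED: Proposition 5, Proposition 3,
the inductive hypothesis (Theorem 4 at level `k − 1`), (1.37), the induction itself; nothing of the node N05 is discharged by this file.
Unit `pub-ymgap-dag-n05-a` (g3), 2026-08-26.  Tree API by name only, nothing restated.
-/

noncomputable section

open NormedSpace

namespace Literature.MathematicalPhysics.QuantumFieldTheory.Balaban1983to89.B8Thm4ExistsLocal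

open Complex (I I_ne_zero)
open MatrixLog B7Prop1Explicit B7Prop2Explicit B7Prop1Local B7Eq92Concrete
open B7Eq78Linearization (conjR conjR_apply)
open B8Ineq130 (tlo thi)
open B8Ineq132 (covDerivFwd)
open B8Eq119TwistedAxial (Restr129)
open B8Eq184Proof (gaugeExp cfgExp eq181)
open B8Eq1110Concrete (ineq1110_scaled)

-- `Site` alone could resolve to the torus sites of `Setup.lean`; re-export the `ℤ^d` sites of `B7Prop1Explicit`.
export B7Prop1Explicit (Site)

variable {d : ℕ}

/-! ## §1 Device: three factors close to `1` -/

section Device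

variable {𝔸 : Type*} [NormedRing 𝔸] [NormOneClass 𝔸]

/-- `‖xyz − 1‖ ≤ (‖x − 1‖ + 1)(‖y − 1‖ + 1)(‖z − 1‖ + 1) − 1` (telescoping `xyz − 1 = (x − 1)yz + (y − 1)z + (z − 1)`). [folklore] -/
private theorem norm_mul_mul_sub_one_le (x y z : 𝔸) :
    ‖x * y * z - 1‖ ≤ (‖x - 1‖ + 1) * (‖y - 1‖ + 1) * (‖z - 1‖ + 1) - 1 := by
  have hy : ‖y‖ ≤ ‖y - 1‖ + 1 := by
    calc ‖y‖ = ‖(y - 1) + 1‖ := by rw [sub_add_cancel]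
      _ ≤ ‖y - 1‖ + ‖(1 : 𝔸)‖ := norm_add_le _ _
      _ = ‖y - 1‖ + 1 := by rw [norm_one]
  have hz : ‖z‖ ≤ ‖z - 1‖ + 1 := by
    calc ‖z‖ = ‖(z - 1) + 1‖ := by rw [sub_add_cancel]
      _ ≤ ‖z - 1‖ + ‖(1 : 𝔸)‖ := norm_add_le _ _
      _ = ‖z - 1‖ + 1 := by rw [norm_one]
  have hid : x * y * z - 1 = (x - 1) * y * z + ((y - 1) * z + (z - 1)) := by noncomm_ring
  rw [hid]
  have h1 : ‖(x - 1) * y * z‖ ≤ ‖x - 1‖ * (‖y - 1‖ + 1) * (‖z - 1‖ + 1) := by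
    calc ‖(x - 1) * y * z‖ ≤ ‖x - 1‖ * ‖y‖ * ‖z‖ :=
          (norm_mul_le _ _).trans (mul_le_mul_of_nonneg_right (norm_mul_le _ _) (norm_nonneg _))
      _ ≤ ‖x - 1‖ * (‖y - 1‖ + 1) * (‖z - 1‖ + 1) := by gcongr
  have h2 : ‖(y - 1) * z‖ ≤ ‖y - 1‖ * (‖z - 1‖ + 1) := (norm_mul_le _ _).trans (by gcongr)
  calc ‖(x - 1) * y * z + ((y - 1) * z + (z - 1))‖ ≤ ‖(x - 1) * y * z‖ + (‖(y - 1) * z‖ + ‖z - 1‖) :=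
        (norm_add_le _ _).trans (add_le_add le_rfl (norm_add_le _ _))
    _ ≤ ‖x - 1‖ * (‖y - 1‖ + 1) * (‖z - 1‖ + 1) + (‖y - 1‖ * (‖z - 1‖ + 1) + ‖z - 1‖) := by gcongr
    _ = (‖x - 1‖ + 1) * (‖y - 1‖ + 1) * (‖z - 1‖ + 1) - 1 := by ring

omit [NormOneClass 𝔸] in
/-- `e^{s} ≤ 1 + s + s²` for `0 ≤ s ≤ 1` (Mathlib's `Real.abs_exp_sub_one_sub_id_le`). [folklore] -/
private theorem rexp_le_quad {s : ℝ} (hs0 : 0 ≤ s) (hs1 : s ≤ 1) : Real.exp s ≤ 1 + s + s ^ 2 := by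
  have h := Real.abs_exp_sub_one_sub_id_le (x := s) (by rw [abs_of_nonneg hs0]; exact hs1)
  rw [abs_le] at h
  nlinarith [h.2, abs_of_nonneg hs0]

variable [NormedAlgebra ℂ 𝔸] [CompleteSpace 𝔸]

omit [NormOneClass 𝔸] in
/-- `‖e^{a} − 1‖ + 1 ≤ e^{‖a‖}`. [folklore] -/
private theorem norm_exp_sub_one_add_one_le (a : 𝔸) : ‖exp a - 1‖ + 1 ≤ Real.exp ‖a‖ := by
  have := Literature.Analysis.Calculus.norm_exp_sub_one_le a
  linarith

end Device

/-! ## §2 At one tower bond: `U₁^{v⁻¹}` in the exponential letters, (1.110), and its logarithm -/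

section Bond

variable {𝔸 : Type*} [NormedRing 𝔸] [NormedAlgebra ℂ 𝔸] [NormOneClass 𝔸] [CompleteSpace 𝔸]

/-- **`‖(U₁^{v⁻¹})_b − 1‖ ≤ 1/4` AT A BOND** under (1.69)/(1.108) in lattice units: `(U₁^{v⁻¹})_b = e^{iηR(v⁻¹(b₋))A_b}·e^{−iλ(b₋)}·
e^{iλ(b₋)+iη(Dλ)(b)}` EXACTLY ((1.81), `B8Eq184Proof.eq181`), and for `‖λ(b₋)‖ ≤ 1/84`, `η‖(Dλ)(b)‖ ≤ 1/84`, `η‖A_b‖ ≤ 1/12` the three exponents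
have norms `≤ e^{1/42}/12`, `1/84`, `1/42` (sum `s ≤ 1/5`), so the product is within `e^{s} − 1 ≤ s + s² ≤ 1/4` of `1` — used below through
`< 1` (`exp ∘ log = id`, `MatrixLog.exp_mlog`) and `≤ 1/4` (`B7Prop2Explicit.star_mlog_eq_neg`). [cite: Balaban1985RegularSpaces, (1.81) p.90, (1.69) p.88, (1.108) p.94] -/
theorem norm_W_sub_one_le {η : ℝ} (hη : 0 < η) (U₀ : Site d → Fin d → 𝔸ˣ) {lam : Site d → 𝔸} (A : Site d → Fin d → 𝔸)
    {x : Site d} (μ : Fin d) (hl : ‖lam x‖ ≤ 1 / 84) (hD : η * ‖covDerivFwd η U₀ μ lam x‖ ≤ 1 / 84) (hA : η * ‖A x μ‖ ≤ 1 / 12) :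
    ‖((mgauge U₀ (fun y => (gaugeExp lam y)⁻¹) (cfgExp η A) x μ : 𝔸ˣ) : 𝔸) - 1‖ ≤ 1 / 4 := by
  rw [eq181 hη.ne' U₀ lam A x μ, Units.val_mul, Units.val_mul, val_expUnit, val_expUnit, val_expUnit]
  -- norms of the three exponents
  have hI : ∀ Z : 𝔸, ‖(I • Z : 𝔸)‖ = ‖Z‖ := fun Z => by rw [norm_smul, Complex.norm_I, one_mul]
  have hη' : ‖(η : ℝ)‖ = η := by rw [Real.norm_eq_abs, abs_of_pos hη]
  have ha : ‖(I • (η • conjR (gaugeExp lam x)⁻¹ (A x μ)) : 𝔸)‖ ≤ Real.exp (1 / 42) * (1 / 12) := by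
    rw [hI, norm_smul, hη', conjR_apply, inv_inv, gaugeExp, val_inv_expUnit, val_expUnit, val_expUnit]
    have h1 : ‖exp (-(I • lam x) : 𝔸)‖ ≤ Real.exp (1 / 84) := by
      have := norm_exp_sub_one_add_one_le (-(I • lam x) : 𝔸)
      have hn : ‖(-(I • lam x) : 𝔸)‖ ≤ 1 / 84 := by rw [norm_neg, hI]; exact hl
      calc ‖exp (-(I • lam x) : 𝔸)‖ = ‖(exp (-(I • lam x)) - 1) + (1 : 𝔸)‖ := by rw [sub_add_cancel]
        _ ≤ ‖exp (-(I • lam x) : 𝔸) - 1‖ + 1 := by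
            refine (norm_add_le _ _).trans ?_; rw [norm_one]
        _ ≤ Real.exp ‖(-(I • lam x) : 𝔸)‖ := this
        _ ≤ Real.exp (1 / 84) := Real.exp_le_exp.mpr hn
    have h2 : ‖exp (I • lam x : 𝔸)‖ ≤ Real.exp (1 / 84) := by
      have := norm_exp_sub_one_add_one_le (I • lam x : 𝔸)
      have hn : ‖(I • lam x : 𝔸)‖ ≤ 1 / 84 := by rw [hI]; exact hl
      calc ‖exp (I • lam x : 𝔸)‖ = ‖(exp (I • lam x) - 1) + (1 : 𝔸)‖ := by rw [sub_add_cancel]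
        _ ≤ ‖exp (I • lam x : 𝔸) - 1‖ + 1 := by
            refine (norm_add_le _ _).trans ?_; rw [norm_one]
        _ ≤ Real.exp ‖(I • lam x : 𝔸)‖ := this
        _ ≤ Real.exp (1 / 84) := Real.exp_le_exp.mpr hn
    have hee : Real.exp (1 / 84) * Real.exp (1 / 84) = Real.exp (1 / 42) := by
      rw [← Real.exp_add]; norm_num
    calc η * ‖exp (-(I • lam x)) * A x μ * exp (I • lam x)‖
        ≤ η * (‖exp (-(I • lam x) : 𝔸)‖ * ‖A x μ‖ * ‖exp (I • lam x : 𝔸)‖) :=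
          mul_le_mul_of_nonneg_left ((norm_mul_le _ _).trans (mul_le_mul_of_nonneg_right (norm_mul_le _ _) (norm_nonneg _)))
            hη.le
      _ ≤ η * (Real.exp (1 / 84) * ‖A x μ‖ * Real.exp (1 / 84)) := by gcongr
      _ = Real.exp (1 / 84) * Real.exp (1 / 84) * (η * ‖A x μ‖) := by ring
      _ ≤ Real.exp (1 / 84) * Real.exp (1 / 84) * (1 / 12) := by gcongr
      _ = Real.exp (1 / 42) * (1 / 12) := by rw [hee]
  have hb : ‖(-(I • lam x) : 𝔸)‖ ≤ 1 / 84 := by rw [norm_neg, hI]; exact hl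
  have hc : ‖(I • lam x + I • (η • covDerivFwd η U₀ μ lam x) : 𝔸)‖ ≤ 1 / 42 := by
    calc ‖(I • lam x + I • (η • covDerivFwd η U₀ μ lam x) : 𝔸)‖ ≤ ‖(I • lam x : 𝔸)‖ + ‖(I • (η • covDerivFwd η U₀ μ lam x) : 𝔸)‖ :=
          norm_add_le _ _
      _ ≤ 1 / 84 + 1 / 84 := by rw [hI, hI, norm_smul, hη']; exact add_le_add hl hD
      _ = 1 / 42 := by norm_num
  -- numerics: `e^{1/42} ≤ 1.03`, total exponent `s ≤ 1.03/12 + 1/84 + 1/42 ≤ 1/5`, `e^{s} − 1 ≤ s + s² ≤ 6/25 < 1/4`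
  have he42 : Real.exp (1 / 42) ≤ 1 + 1 / 42 + (1 / 42) ^ 2 := rexp_le_quad (by norm_num) (by norm_num)
  set s : ℝ := ‖(I • (η • conjR (gaugeExp lam x)⁻¹ (A x μ)) : 𝔸)‖ + ‖(-(I • lam x) : 𝔸)‖ +
    ‖(I • lam x + I • (η • covDerivFwd η U₀ μ lam x) : 𝔸)‖ with hs
  have hs0 : 0 ≤ s := by positivity
  have hs1 : s ≤ 1 / 5 := by
    have : Real.exp (1 / 42) * (1 / 12) ≤ 9 / 100 := by nlinarith
    linarith
  have hprod := norm_mul_mul_sub_one_le (exp (I • (η • conjR (gaugeExp lam x)⁻¹ (A x μ))) : 𝔸) (exp (-(I • lam x)))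
    (exp (I • lam x + I • (η • covDerivFwd η U₀ μ lam x)))
  have hbound : (‖exp (I • (η • conjR (gaugeExp lam x)⁻¹ (A x μ))) - (1 : 𝔸)‖ + 1) * (‖exp (-(I • lam x)) - (1 : 𝔸)‖ + 1) *
      (‖exp (I • lam x + I • (η • covDerivFwd η U₀ μ lam x)) - (1 : 𝔸)‖ + 1) ≤ Real.exp s := by
    rw [hs, Real.exp_add, Real.exp_add]
    have e1 := norm_exp_sub_one_add_one_le (I • (η • conjR (gaugeExp lam x)⁻¹ (A x μ)) : 𝔸)
    have e2 := norm_exp_sub_one_add_one_le (-(I • lam x) : 𝔸)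
    have e3 := norm_exp_sub_one_add_one_le (I • lam x + I • (η • covDerivFwd η U₀ μ lam x) : 𝔸)
    gcongr
  have hes : Real.exp s ≤ 1 + s + s ^ 2 := rexp_le_quad hs0 (hs1.trans (by norm_num))
  have h4 : Real.exp s - 1 ≤ 1 / 4 := by nlinarith
  linarith [hprod, hbound]

/-- **(1.110) AND THE EXPONENTIAL READING OF `U₁^{v⁻¹}` AT ONE TOWER BOND.**  Let `b = ⟨x, x + e_κ⟩` be a bond with `v(x) = e^{iλ(x)}`,
`v(x + e_κ) = e^{iλ(x + e_κ)}`, `U₁(b) = e^{iηA_b}`, (1.69) `‖A_b‖ ≤ c·t`, (1.108) `‖λ(x)‖ ≤ α₄`, `‖(Dλ)(b)‖ ≤ α₄·t` (`t = (Lʲη)⁻¹`, `ηt ≤ 1`),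
`α₄ ≤ 1/84`, `c ≤ 1/12`.  Then for `A′_b := (1/iη) log (U₁^{v⁻¹})_b`: `‖A′_b‖ ≤ (2c + 8α₄)·t` ((1.110), `B8Eq1110Concrete.ineq1110_scaled`) and
`e^{iηA′_b} = (U₁^{v⁻¹})_b` (the bond variable is within `1/4` of `1`, `norm_W_sub_one_le`, so `exp ∘ log = id`).
[cite: Balaban1985RegularSpaces, (1.110) p.95, (1.108) p.94, (1.69) p.88, (1.84) p.90] -/
theorem bond_1110_local {η : ℝ} (hη : 0 < η) (U₀ U₁ : Site d → Fin d → 𝔸ˣ) (v : Site d → 𝔸ˣ) {lam : Site d → 𝔸}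
    (A : Site d → Fin d → 𝔸) {x : Site d} (κ : Fin d) {c α₄ t : ℝ} (hc : 0 ≤ c) (hα₄ : 0 ≤ α₄) (ht : 0 ≤ t) (hηt : η * t ≤ 1)
    (hvx : (v x : 𝔸) = ((gaugeExp lam x : 𝔸ˣ) : 𝔸)) (hvxe : (v (x + e κ) : 𝔸) = ((gaugeExp lam (x + e κ) : 𝔸ˣ) : 𝔸))
    (hU₁ : U₁ x κ = cfgExp η A x κ)
    (hl : ‖lam x‖ ≤ α₄) (hD : ‖covDerivFwd η U₀ κ lam x‖ ≤ α₄ * t) (hAb : ‖A x κ‖ ≤ c * t)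
    (hs₁ : α₄ ≤ 1 / 84) (hs₂ : c ≤ 1 / 12) :
    ‖η⁻¹ • ((I⁻¹ : ℂ) • mlog ((mgauge U₀ v⁻¹ U₁ x κ : 𝔸ˣ) : 𝔸))‖ ≤ (2 * c + 8 * α₄) * t ∧
      cfgExp η (fun y μ => η⁻¹ • ((I⁻¹ : ℂ) • mlog ((mgauge U₀ v⁻¹ U₁ y μ : 𝔸ˣ) : 𝔸))) x κ = mgauge U₀ v⁻¹ U₁ x κ ∧
      ‖((mgauge U₀ v⁻¹ U₁ x κ : 𝔸ˣ) : 𝔸) - 1‖ ≤ 1 / 4 := by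
  -- the bond variable in the exponential letters
  have hvx' : v x = gaugeExp lam x := Units.ext hvx
  have hvxe' : v (x + e κ) = gaugeExp lam (x + e κ) := Units.ext hvxe
  have hW : mgauge U₀ v⁻¹ U₁ x κ = mgauge U₀ (fun y => (gaugeExp lam y)⁻¹) (cfgExp η A) x κ := by
    rw [mgauge_apply, mgauge_apply, Pi.inv_apply, Pi.inv_apply, hvx', hvxe', hU₁]
  -- the smallness in lattice units
  have hηα : η * (α₄ * t) ≤ 1 / 70 := by
    calc η * (α₄ * t) = α₄ * (η * t) := by ring
      _ ≤ α₄ * 1 := mul_le_mul_of_nonneg_left hηt hα₄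
      _ ≤ 1 / 70 := by linarith
  have hηc : η * (c * t) ≤ 1 / 12 := by
    calc η * (c * t) = c * (η * t) := by ring
      _ ≤ c * 1 := mul_le_mul_of_nonneg_left hηt hc
      _ ≤ 1 / 12 := by linarith
  have hnear : ‖((mgauge U₀ v⁻¹ U₁ x κ : 𝔸ˣ) : 𝔸) - 1‖ ≤ 1 / 4 := by
    rw [hW]
    refine norm_W_sub_one_le hη U₀ A κ (hl.trans hs₁) ?_ ?_
    · calc η * ‖covDerivFwd η U₀ κ lam x‖ ≤ η * (α₄ * t) := mul_le_mul_of_nonneg_left hD hη.le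
        _ ≤ 1 / 84 := by
          calc η * (α₄ * t) = α₄ * (η * t) := by ring
            _ ≤ α₄ * 1 := mul_le_mul_of_nonneg_left hηt hα₄
            _ ≤ 1 / 84 := by linarith
    · exact (mul_le_mul_of_nonneg_left hAb hη.le).trans hηc
  refine ⟨?_, ?_, hnear⟩
  · rw [hW]
    exact ineq1110_scaled hη U₀ A κ hc hα₄ ht hηt hl hD hAb hs₁ hηα hηc
  · -- `e^{iη A′_b} = e^{log W_b} = W_b`
    have harg : (I : ℂ) • (η • (η⁻¹ • ((I⁻¹ : ℂ) • mlog ((mgauge U₀ v⁻¹ U₁ x κ : 𝔸ˣ) : 𝔸)))) =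
        mlog ((mgauge U₀ v⁻¹ U₁ x κ : 𝔸ˣ) : 𝔸) := by
      rw [smul_smul η η⁻¹, mul_inv_cancel₀ hη.ne', one_smul, smul_smul, mul_inv_cancel₀ I_ne_zero, one_smul]
    apply Units.ext
    show exp ((I : ℂ) • (η • (η⁻¹ • ((I⁻¹ : ℂ) • mlog ((mgauge U₀ v⁻¹ U₁ x κ : 𝔸ˣ) : 𝔸))))) = _
    rw [harg]
    exact exp_mlog (hnear.trans_lt (by norm_num))

end Bond

/-! ## §3 The existence clause of Theorem 4 at level `k`, given the inductive datum and Proposition 5's existence clause -/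

section Main

variable {𝔸 : Type*} [CStarAlgebra 𝔸] [Nontrivial 𝔸]
variable {L k : ℕ} {η : ℝ} {Λ : ℕ → Set (Site d)} {U₀ U' U₁ : Site d → Fin d → 𝔸ˣ} {u₁ v : Site d → 𝔸ˣ}
  {A : Site d → Fin d → 𝔸} {lam : Site d → 𝔸} {c α₄ : ℝ}

/-- **THEOREM 4, EXISTENCE CLAUSE AT LEVEL `k`, WITH THE WITNESS DISPLAYED** («The composition u = u′u₁ of these two gauge transformations
is the transformation we are looking for», p. 89; pp. 94–95).  DATA: the inductive datum `u₁`, `U₁ = U′^{u₁⁻¹}` (`mgauge U₀ u₁ U₁ = U′`),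
`A` with `U₁ = e^{iηA}` on the bonds of every tower `Bʲ(y)`, `y ∈ Λ_j`, `j ≤ k` (`AgreeOn`) and the first bound of (1.69) there, `‖A_b‖ ≤
c(Lʲη)⁻¹`; Proposition 5's existence clause for this datum as the data `v, λ`: `v = e^{iλ}` on the towers with (1.108) `‖λ‖ ≤ α₄`,
`(Lʲη)‖Dλ‖ ≤ α₄` there, solving (1.107) — `Lan (U₁^{v⁻¹})` ((1.38) for `U₁^{v⁻¹}`, abstract) and (1.29) for `u₁v` (`Restr129`); unitary
values; smallness `α₄ ≤ 1/84`, `c ≤ 1/12`.  CONCLUSION for `u := u₁v` (print `u′u₁`) and `W := U₁^{v⁻¹}`: `W = U′^{u⁻¹}` (i.e. `U′ = W^{u}`),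
`u` satisfies (1.29), `W` satisfies (1.38), and with `A′ := (1/iη) log W` bondwise: `W = e^{iηA′}` on the bonds of every tower (`AgreeOn`),
`A′` self-adjoint there, and (1.62) `‖A′_b‖ ≤ (2c + 8α₄)(Lʲη)⁻¹` there ((1.110)–(1.111)). [cite: Balaban1985RegularSpaces, Thm 4 p.88, p.89, Prop. 5 (1.107)–(1.108) p.94, (1.110)–(1.111) p.95] -/
theorem thm4_exists_step_witness (hL1 : 1 ≤ L) (hη : 0 < η)
    (hU₀ : ∀ x κ, U₀ x κ ∈ unitaryUnits 𝔸) (hU' : ∀ x κ, U' x κ ∈ unitaryUnits 𝔸)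
    (hu₁ : ∀ x, u₁ x ∈ unitaryUnits 𝔸) (hv : ∀ x, v x ∈ unitaryUnits 𝔸)
    (hc : 0 ≤ c) (hα₄ : 0 ≤ α₄) (hs₁ : α₄ ≤ 1 / 84) (hs₂ : c ≤ 1 / 12)
    (h₁ : mgauge U₀ u₁ U₁ = U')
    (hA : ∀ j, j ≤ k → ∀ y ∈ Λ j, AgreeOn (tlo L y j) (thi L y j) U₁ (cfgExp η A))
    (h69 : ∀ j, j ≤ k → ∀ y ∈ Λ j, ∀ (x : Site d) (κ : Fin d), InBox (tlo L y j) (thi L y j) x →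
      InBox (tlo L y j) (thi L y j) (x + e κ) → ‖A x κ‖ ≤ c * ((L : ℝ) ^ j * η)⁻¹)
    (hvlam : ∀ j, j ≤ k → ∀ y ∈ Λ j, ∀ x : Site d, InBox (tlo L y j) (thi L y j) x → (v x : 𝔸) = ((gaugeExp lam x : 𝔸ˣ) : 𝔸))
    (h108 : ∀ j, j ≤ k → ∀ y ∈ Λ j, ∀ x : Site d, InBox (tlo L y j) (thi L y j) x → ‖lam x‖ ≤ α₄ ∧
      ∀ κ : Fin d, InBox (tlo L y j) (thi L y j) (x + e κ) → ((L : ℝ) ^ j * η) * ‖covDerivFwd η U₀ κ lam x‖ ≤ α₄)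
    (Lan : (Site d → Fin d → 𝔸ˣ) → Prop) (hLan : Lan (mgauge U₀ v⁻¹ U₁)) (h129 : Restr129 L k Λ U₀ (u₁ * v)) :
    mgauge U₀ (u₁ * v) (mgauge U₀ v⁻¹ U₁) = U' ∧ Restr129 L k Λ U₀ (u₁ * v) ∧ Lan (mgauge U₀ v⁻¹ U₁) ∧
      ∀ j, j ≤ k → ∀ y ∈ Λ j,
        AgreeOn (tlo L y j) (thi L y j) (mgauge U₀ v⁻¹ U₁)
            (cfgExp η (fun y μ => η⁻¹ • ((I⁻¹ : ℂ) • mlog ((mgauge U₀ v⁻¹ U₁ y μ : 𝔸ˣ) : 𝔸)))) ∧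
          ∀ (x : Site d) (κ : Fin d), InBox (tlo L y j) (thi L y j) x → InBox (tlo L y j) (thi L y j) (x + e κ) →
            IsSelfAdjoint (η⁻¹ • ((I⁻¹ : ℂ) • mlog ((mgauge U₀ v⁻¹ U₁ x κ : 𝔸ˣ) : 𝔸))) ∧
              ‖η⁻¹ • ((I⁻¹ : ℂ) • mlog ((mgauge U₀ v⁻¹ U₁ x κ : 𝔸ˣ) : 𝔸))‖ ≤ (2 * c + 8 * α₄) * ((L : ℝ) ^ j * η)⁻¹ := by
  have hLr : (1 : ℝ) ≤ L := by exact_mod_cast hL1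
  refine ⟨?_, h129, hLan, fun j hjk y hy => ?_⟩
  · -- `U′ = U₁^{u₁} = (U₁^{v⁻¹})^{u₁v}`
    rw [B7Eq106Concrete.mgauge_mgauge, mul_assoc, mul_inv_cancel, mul_one, h₁]
  · have ht : 0 ≤ ((L : ℝ) ^ j * η)⁻¹ := by positivity
    have hηt : η * ((L : ℝ) ^ j * η)⁻¹ ≤ 1 := by
      have hLj : (1 : ℝ) ≤ (L : ℝ) ^ j := one_le_pow₀ hLr
      have e : η * ((L : ℝ) ^ j * η)⁻¹ = ((L : ℝ) ^ j)⁻¹ := by field_simp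
      rw [e]
      exact inv_le_one_of_one_le₀ hLj
    -- at each tower bond: the two conclusions of `bond_1110_local`
    have hpos : (0 : ℝ) < (L : ℝ) ^ j * η := by positivity
    have hbond : ∀ (x : Site d) (κ : Fin d), InBox (tlo L y j) (thi L y j) x → InBox (tlo L y j) (thi L y j) (x + e κ) →
        ‖η⁻¹ • ((I⁻¹ : ℂ) • mlog ((mgauge U₀ v⁻¹ U₁ x κ : 𝔸ˣ) : 𝔸))‖ ≤ (2 * c + 8 * α₄) * ((L : ℝ) ^ j * η)⁻¹ ∧
          cfgExp η (fun y μ => η⁻¹ • ((I⁻¹ : ℂ) • mlog ((mgauge U₀ v⁻¹ U₁ y μ : 𝔸ˣ) : 𝔸))) x κ = mgauge U₀ v⁻¹ U₁ x κ ∧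
          ‖((mgauge U₀ v⁻¹ U₁ x κ : 𝔸ˣ) : 𝔸) - 1‖ ≤ 1 / 4 := by
      intro x κ hx hxe
      obtain ⟨hl, hDall⟩ := h108 j hjk y hy x hx
      have hD : ‖covDerivFwd η U₀ κ lam x‖ ≤ α₄ * ((L : ℝ) ^ j * η)⁻¹ := by
        rw [← div_eq_mul_inv]
        exact (le_div_iff₀' hpos).2 (hDall κ hxe)
      exact bond_1110_local hη U₀ U₁ v A κ hc hα₄ ht hηt (hvlam j hjk y hy x hx) (hvlam j hjk y hy (x + e κ) hxe)
        (hA j hjk y hy x κ hx hxe) hl hD (h69 j hjk y hy x κ hx hxe) hs₁ hs₂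
    refine ⟨fun x κ hx hxe => ((hbond x κ hx hxe).2.1).symm, fun x κ hx hxe => ⟨?_, (hbond x κ hx hxe).1⟩⟩
    -- self-adjointness: `W_b` is unitary and within `1/4` of `1`
    have hWu : ((mgauge U₀ v⁻¹ U₁ x κ : 𝔸ˣ) : 𝔸) ∈ unitary 𝔸 := by
      have hU₁u : ∀ (x : Site d) (κ : Fin d), U₁ x κ ∈ unitaryUnits 𝔸 := by
        intro x κ
        have hinv : mgauge U₀ u₁⁻¹ U' = U₁ := by
          rw [← h₁, B7Eq106Concrete.mgauge_mgauge, inv_mul_cancel]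
          funext z μ; simp [mgauge_apply]
        rw [← hinv, mgauge_apply, Pi.inv_apply]
        refine (unitaryUnits 𝔸).mul_mem ((unitaryUnits 𝔸).mul_mem ((unitaryUnits 𝔸).inv_mem (hu₁ x)) (hU' x κ)) ?_
        refine (unitaryUnits 𝔸).inv_mem ?_
        rw [Rc_apply, Pi.inv_apply]
        exact (unitaryUnits 𝔸).mul_mem ((unitaryUnits 𝔸).mul_mem (hU₀ x κ) ((unitaryUnits 𝔸).inv_mem (hu₁ _)))
          ((unitaryUnits 𝔸).inv_mem (hU₀ x κ))
      refine mem_unitaryUnits.1 ?_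
      rw [mgauge_apply, Pi.inv_apply]
      refine (unitaryUnits 𝔸).mul_mem ((unitaryUnits 𝔸).mul_mem ((unitaryUnits 𝔸).inv_mem (hv x)) (hU₁u x κ)) ?_
      refine (unitaryUnits 𝔸).inv_mem ?_
      rw [Rc_apply, Pi.inv_apply]
      exact (unitaryUnits 𝔸).mul_mem ((unitaryUnits 𝔸).mul_mem (hU₀ x κ) ((unitaryUnits 𝔸).inv_mem (hv _)))
        ((unitaryUnits 𝔸).inv_mem (hU₀ x κ))
    have hnear : ‖((mgauge U₀ v⁻¹ U₁ x κ : 𝔸ˣ) : 𝔸) - 1‖ ≤ 1 / 4 := (hbond x κ hx hxe).2.2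
    -- `((1/iη) log W_b)⋆ = (1/iη) log W_b`
    show star (η⁻¹ • ((I⁻¹ : ℂ) • mlog ((mgauge U₀ v⁻¹ U₁ x κ : 𝔸ˣ) : 𝔸))) = _
    rw [star_smul, star_smul, star_mlog_eq_neg hWu hnear, Complex.inv_I, Complex.star_def, map_neg, Complex.conj_I, neg_neg,
      smul_neg, neg_smul, star_trivial]

/-- **THEOREM 4, EXISTENCE CLAUSE AT LEVEL `k`** (p. 88: «there exists … gauge transformation u satisfying (1.29) and such that the
conditions (1.37), (1.38), (1.62) hold for the configuration U₁ = U′^{u⁻¹}» — existence part; proof pp. 89, 94–95), ON THE CONCRETE `ℤᵈ`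
CARRIERS, GIVEN THE INDUCTIVE DATUM (1.68)–(1.69) AND PROPOSITION 5's EXISTENCE CLAUSE (1.107)–(1.108) for it (hypothesis data as in
`thm4_exists_step_witness`): there is a unitary-valued gauge transformation `u` with (1.29) (`Restr129`) such that `U′^{u⁻¹}` — the
configuration `W` with `mgauge U₀ u W = U′` — satisfies (1.38) (`Lan W`) and (1.62) in the exponential reading on the towers: for some
`A′`, `W = e^{iηA′}` on the bonds of every `Bʲ(y)`, `y ∈ Λ_j`, `j ≤ k`, `A′` self-adjoint there and `‖A′_b‖ ≤ (2c + 8α₄)(Lʲη)⁻¹` there.  ((1.37)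
for `W` is the carrier law `B8Eq137QjEqB`, not restated.) [cite: Balaban1985RegularSpaces, Thm 4 p.88, proof pp.89 + 94–95, Prop. 5 (1.107)–(1.108) p.94, (1.110)–(1.111) p.95] -/
theorem thm4_exists_step_local (hL1 : 1 ≤ L) (hη : 0 < η)
    (hU₀ : ∀ x κ, U₀ x κ ∈ unitaryUnits 𝔸) (hU' : ∀ x κ, U' x κ ∈ unitaryUnits 𝔸)
    (hu₁ : ∀ x, u₁ x ∈ unitaryUnits 𝔸) (hv : ∀ x, v x ∈ unitaryUnits 𝔸)
    (hc : 0 ≤ c) (hα₄ : 0 ≤ α₄) (hs₁ : α₄ ≤ 1 / 84) (hs₂ : c ≤ 1 / 12)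
    (h₁ : mgauge U₀ u₁ U₁ = U')
    (hA : ∀ j, j ≤ k → ∀ y ∈ Λ j, AgreeOn (tlo L y j) (thi L y j) U₁ (cfgExp η A))
    (h69 : ∀ j, j ≤ k → ∀ y ∈ Λ j, ∀ (x : Site d) (κ : Fin d), InBox (tlo L y j) (thi L y j) x →
      InBox (tlo L y j) (thi L y j) (x + e κ) → ‖A x κ‖ ≤ c * ((L : ℝ) ^ j * η)⁻¹)
    (hvlam : ∀ j, j ≤ k → ∀ y ∈ Λ j, ∀ x : Site d, InBox (tlo L y j) (thi L y j) x → (v x : 𝔸) = ((gaugeExp lam x : 𝔸ˣ) : 𝔸))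
    (h108 : ∀ j, j ≤ k → ∀ y ∈ Λ j, ∀ x : Site d, InBox (tlo L y j) (thi L y j) x → ‖lam x‖ ≤ α₄ ∧
      ∀ κ : Fin d, InBox (tlo L y j) (thi L y j) (x + e κ) → ((L : ℝ) ^ j * η) * ‖covDerivFwd η U₀ κ lam x‖ ≤ α₄)
    (Lan : (Site d → Fin d → 𝔸ˣ) → Prop) (hLan : Lan (mgauge U₀ v⁻¹ U₁)) (h129 : Restr129 L k Λ U₀ (u₁ * v)) :
    ∃ u : Site d → 𝔸ˣ, (∀ x, u x ∈ unitaryUnits 𝔸) ∧ Restr129 L k Λ U₀ u ∧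
      ∃ W : Site d → Fin d → 𝔸ˣ, mgauge U₀ u W = U' ∧ Lan W ∧
        ∃ A' : Site d → Fin d → 𝔸, ∀ j, j ≤ k → ∀ y ∈ Λ j,
          AgreeOn (tlo L y j) (thi L y j) W (cfgExp η A') ∧
            ∀ (x : Site d) (κ : Fin d), InBox (tlo L y j) (thi L y j) x → InBox (tlo L y j) (thi L y j) (x + e κ) →
              IsSelfAdjoint (A' x κ) ∧ ‖A' x κ‖ ≤ (2 * c + 8 * α₄) * ((L : ℝ) ^ j * η)⁻¹ := by
  obtain ⟨hW, h29, hL, hrest⟩ := thm4_exists_step_witness hL1 hη hU₀ hU' hu₁ hv hc hα₄ hs₁ hs₂ h₁ hA h69 hvlam h108 Lan hLan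
    h129
  refine ⟨u₁ * v, fun x => ?_, h29, mgauge U₀ v⁻¹ U₁, hW, hL, _, hrest⟩
  rw [Pi.mul_apply]
  exact (unitaryUnits 𝔸).mul_mem (hu₁ x) (hv x)

end Main

/-! ## §4 (v2) The same step with the bounds READ ON ARBITRARY BOND SETS `E_j` (print's «on Ω_j» currency)

APPEND-ONLY v2 (same seat, same day).  §3 reads and concludes on the bonds with both ends in one tower `Bʲ(y)`.  For the INDUCTION of
Theorem 4 this currency is too narrow: the level-`(k+1)` step needs (1.69) — i.e. this step's (1.62) output — on ALL bonds of `Ω_j`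
(print), in particular on the bonds of `B^{k+1}(y)` crossing between adjacent sub-blocks `Bᵏ(y′)`, `Bᵏ(y″)`, which are tower bonds of no
level-`k` tower of the truncated datum.  Since every ingredient of the step is POINTWISE AT A BOND (`bond_1110_local`), the step holds with
the hypotheses read, level by level, on an ARBITRARY family of bond sets `E j ⊆ ℤᵈ × {directions}` (`j ≤ k`, scale `(Lʲη)⁻¹`) and the
conclusions delivered on the same sets: print's choice is `E j` = the bonds of `Ω_j`; §3 is the instance `E j` = the tower bonds over `Λ_j`. -/

section OnBonds

variable {𝔸 : Type*} [CStarAlgebra 𝔸] [Nontrivial 𝔸]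
variable {L k : ℕ} {η : ℝ} {Λ : ℕ → Set (Site d)} {U₀ U' U₁ : Site d → Fin d → 𝔸ˣ} {u₁ v : Site d → 𝔸ˣ}
  {A : Site d → Fin d → 𝔸} {lam : Site d → 𝔸} {c α₄ : ℝ}

omit [Nontrivial 𝔸] in
/-- `U₁ = U′^{u₁⁻¹}` and `U₁^{v⁻¹}` are unitary-valued for unitary-valued `U₀, U′, u₁, v` ((55) of [3] multiplies unitaries). [folklore] -/
private theorem mgauge_inv_mem_unitary (hU₀ : ∀ x κ, U₀ x κ ∈ unitaryUnits 𝔸) (hU' : ∀ x κ, U' x κ ∈ unitaryUnits 𝔸)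
    (hu₁ : ∀ x, u₁ x ∈ unitaryUnits 𝔸) (hv : ∀ x, v x ∈ unitaryUnits 𝔸) (h₁ : mgauge U₀ u₁ U₁ = U') (x : Site d) (κ : Fin d) :
    ((mgauge U₀ v⁻¹ U₁ x κ : 𝔸ˣ) : 𝔸) ∈ unitary 𝔸 := by
  have hmem : ∀ {u : Site d → 𝔸ˣ} {W : Site d → Fin d → 𝔸ˣ}, (∀ x, u x ∈ unitaryUnits 𝔸) → (∀ x κ, W x κ ∈ unitaryUnits 𝔸) →
      ∀ (x : Site d) (κ : Fin d), mgauge U₀ u⁻¹ W x κ ∈ unitaryUnits 𝔸 := by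
    intro u W hu hW x κ
    rw [mgauge_apply, Pi.inv_apply]
    refine (unitaryUnits 𝔸).mul_mem ((unitaryUnits 𝔸).mul_mem ((unitaryUnits 𝔸).inv_mem (hu x)) (hW x κ)) ?_
    refine (unitaryUnits 𝔸).inv_mem ?_
    rw [Rc_apply, Pi.inv_apply]
    exact (unitaryUnits 𝔸).mul_mem ((unitaryUnits 𝔸).mul_mem (hU₀ x κ) ((unitaryUnits 𝔸).inv_mem (hu _)))
      ((unitaryUnits 𝔸).inv_mem (hU₀ x κ))
  have hinv : mgauge U₀ u₁⁻¹ U' = U₁ := by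
    rw [← h₁, B7Eq106Concrete.mgauge_mgauge, inv_mul_cancel]
    funext z μ; simp [mgauge_apply]
  have hU₁u : ∀ (x : Site d) (κ : Fin d), U₁ x κ ∈ unitaryUnits 𝔸 := fun x κ => by rw [← hinv]; exact hmem hu₁ hU' x κ
  exact mem_unitaryUnits.1 (hmem hv hU₁u x κ)

omit [Nontrivial 𝔸] in
/-- `((1/iη) log W)⋆ = (1/iη) log W` for a unitary `W` within `1/4` of `1` (`B7Prop2Explicit.star_mlog_eq_neg`). [cite: Balaban1985RegularSpaces, (1.36) p.82 ("U₁ = e^{iηA}", A 𝔤-valued)] -/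
private theorem isSelfAdjoint_etaInv_log {W : 𝔸} (hWu : W ∈ unitary 𝔸) (hnear : ‖W - 1‖ ≤ 1 / 4) :
    IsSelfAdjoint (η⁻¹ • ((I⁻¹ : ℂ) • mlog W)) := by
  show star (η⁻¹ • ((I⁻¹ : ℂ) • mlog W)) = _
  rw [star_smul, star_smul, star_mlog_eq_neg hWu hnear, Complex.inv_I, Complex.star_def, map_neg, Complex.conj_I, neg_neg,
    smul_neg, neg_smul, star_trivial]

/-- **THEOREM 4, EXISTENCE CLAUSE AT LEVEL `k`, READ ON ARBITRARY BOND SETS** (print's currency «on Ω_j, j = 0, …, k»: take `E j` = the bonds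
of `Ω_j`).  DATA as in `thm4_exists_step_local`, but the bondwise hypotheses — `U₁ = e^{iηA}` and (1.69) `‖A_b‖ ≤ c(Lʲη)⁻¹`, `v = e^{iλ}` at both
ends of the bond, (1.108) `‖λ(b₋)‖ ≤ α₄`, `(Lʲη)‖(Dλ)(b)‖ ≤ α₄` — are read at every bond `b = (x, κ) ∈ E j`, `j ≤ k`, for an arbitrary family
`E : ℕ → Set (Site d × Fin d)`; Proposition 5's conclusions `Lan (U₁^{v⁻¹})`, `Restr129 (u₁v)` as before.  CONCLUSION: `∃ u` (= `u₁v`)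
unitary-valued with (1.29), `∃ W` (= `U₁^{v⁻¹}`) with `U′ = W^{u}` and (1.38) `Lan W`, `∃ A′` with, at every `b ∈ E j`, `j ≤ k`: `W_b = e^{iηA′_b}`,
`A′_b` self-adjoint, and (1.62) `‖A′_b‖ ≤ (2c + 8α₄)(Lʲη)⁻¹` ((1.110)–(1.111)).  This is the form the induction `k ↦ k + 1` composes (the
next step reads (1.69) on all bonds of `Ω_j`, including those crossing between sub-blocks). [cite: Balaban1985RegularSpaces, Thm 4 p.88, proof pp.89 + 94–95, (1.110)–(1.111) p.95, Prop. 5 (1.107)–(1.108) p.94] -/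
theorem thm4_exists_step_onBonds (hL1 : 1 ≤ L) (hη : 0 < η)
    (hU₀ : ∀ x κ, U₀ x κ ∈ unitaryUnits 𝔸) (hU' : ∀ x κ, U' x κ ∈ unitaryUnits 𝔸)
    (hu₁ : ∀ x, u₁ x ∈ unitaryUnits 𝔸) (hv : ∀ x, v x ∈ unitaryUnits 𝔸)
    (hc : 0 ≤ c) (hα₄ : 0 ≤ α₄) (hs₁ : α₄ ≤ 1 / 84) (hs₂ : c ≤ 1 / 12)
    (h₁ : mgauge U₀ u₁ U₁ = U') (E : ℕ → Set (Site d × Fin d))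
    (hA : ∀ j, j ≤ k → ∀ b ∈ E j, U₁ b.1 b.2 = cfgExp η A b.1 b.2)
    (h69 : ∀ j, j ≤ k → ∀ b ∈ E j, ‖A b.1 b.2‖ ≤ c * ((L : ℝ) ^ j * η)⁻¹)
    (hvlam : ∀ j, j ≤ k → ∀ b ∈ E j,
      (v b.1 : 𝔸) = ((gaugeExp lam b.1 : 𝔸ˣ) : 𝔸) ∧ (v (b.1 + e b.2) : 𝔸) = ((gaugeExp lam (b.1 + e b.2) : 𝔸ˣ) : 𝔸))
    (h108 : ∀ j, j ≤ k → ∀ b ∈ E j, ‖lam b.1‖ ≤ α₄ ∧ ((L : ℝ) ^ j * η) * ‖covDerivFwd η U₀ b.2 lam b.1‖ ≤ α₄)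
    (Lan : (Site d → Fin d → 𝔸ˣ) → Prop) (hLan : Lan (mgauge U₀ v⁻¹ U₁)) (h129 : Restr129 L k Λ U₀ (u₁ * v)) :
    ∃ u : Site d → 𝔸ˣ, (∀ x, u x ∈ unitaryUnits 𝔸) ∧ Restr129 L k Λ U₀ u ∧
      ∃ W : Site d → Fin d → 𝔸ˣ, mgauge U₀ u W = U' ∧ Lan W ∧
        ∃ A' : Site d → Fin d → 𝔸, ∀ j, j ≤ k → ∀ b ∈ E j,
          W b.1 b.2 = cfgExp η A' b.1 b.2 ∧ IsSelfAdjoint (A' b.1 b.2) ∧ ‖A' b.1 b.2‖ ≤ (2 * c + 8 * α₄) * ((L : ℝ) ^ j * η)⁻¹ := by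
  have hLr : (1 : ℝ) ≤ L := by exact_mod_cast hL1
  refine ⟨u₁ * v, fun x => ?_, h129, mgauge U₀ v⁻¹ U₁, ?_, hLan,
    fun y μ => η⁻¹ • ((I⁻¹ : ℂ) • mlog ((mgauge U₀ v⁻¹ U₁ y μ : 𝔸ˣ) : 𝔸)), fun j hjk b hb => ?_⟩
  · rw [Pi.mul_apply]
    exact (unitaryUnits 𝔸).mul_mem (hu₁ x) (hv x)
  · rw [B7Eq106Concrete.mgauge_mgauge, mul_assoc, mul_inv_cancel, mul_one, h₁]
  · have ht : 0 ≤ ((L : ℝ) ^ j * η)⁻¹ := by positivity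
    have hpos : (0 : ℝ) < (L : ℝ) ^ j * η := by positivity
    have hηt : η * ((L : ℝ) ^ j * η)⁻¹ ≤ 1 := by
      have hLj : (1 : ℝ) ≤ (L : ℝ) ^ j := one_le_pow₀ hLr
      have e : η * ((L : ℝ) ^ j * η)⁻¹ = ((L : ℝ) ^ j)⁻¹ := by field_simp
      rw [e]
      exact inv_le_one_of_one_le₀ hLj
    obtain ⟨hl, hD'⟩ := h108 j hjk b hb
    have hD : ‖covDerivFwd η U₀ b.2 lam b.1‖ ≤ α₄ * ((L : ℝ) ^ j * η)⁻¹ := by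
      rw [← div_eq_mul_inv]
      exact (le_div_iff₀' hpos).2 hD'
    obtain ⟨hbd, hexp, hnear⟩ := bond_1110_local hη U₀ U₁ v A b.2 hc hα₄ ht hηt (hvlam j hjk b hb).1 (hvlam j hjk b hb).2
      (hA j hjk b hb) hl hD (h69 j hjk b hb) hs₁ hs₂
    exact ⟨hexp.symm, isSelfAdjoint_etaInv_log (mgauge_inv_mem_unitary hU₀ hU' hu₁ hv h₁ b.1 b.2) hnear, hbd⟩

end OnBonds

end Literature.MathematicalPhysics.QuantumFieldTheory.Balaban1983to89.B8Thm4ExistsLocal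

end
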